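import Literature.Geometry.GeometricMeasureTheory.CurrentsVariation

/-!
# The variation measure `‖T‖` of a current

Federer 4.1.5 / 4.1.7: the set function `U ↦ ‖T‖(U) = sup {T(φ) : spt φ ⊆ U, ‖φ‖ ≤ 1}` on open sets
(`Current.variationOn` of `CurrentsVariation.lean`) extends to a Borel measure, the **variation
measure** `‖T‖` of the current `T ∈ 𝒟_m(Ω)`. This file performs the extension for the currents of
`Currents.lean` on an open subset `Ω` of a finite-dimensional real normed space `E`:

* `Current.add_le_variationOn_union` — `‖T‖(U₁) + ‖T‖(U₂) ≤ ‖T‖(U₁ ∪ U₂)` for disjoint sets;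
* `Current.variationOn_iUnion_le` — `‖T‖(⋃ Uᵢ) ≤ Σ ‖T‖(Uᵢ)` for open sets (smooth partitions of
  unity);
* `Current.variationOuter` — the outer measure `A ↦ inf {‖T‖(U) : U ⊇ A open}`; it agrees with
  `‖T‖(U)` on open sets (`variationOuter_apply_of_isOpen`) and every open set is Carathéodory
  measurable (`isCaratheodory_of_isOpen`);
* `Current.variation T : Measure E` — **the variation measure**: the Borel measure induced by
  `variationOuter`, restricted to `Ω` (so that `‖T‖(E ∖ Ω) = 0`: `‖T‖` is a measure "in `Ω`");
  `variation_apply_of_isOpen : ‖T‖(U) = variationOn T U`, `variation_univ : ‖T‖(E) = 𝐌(T)`,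
  `ofReal_apply_le_variation : T(φ) ≤ ‖T‖(spt φ)` for `‖φ‖ ≤ 1`, outer regularity
  `variation_eq_iInf_isOpen`, finiteness when `𝐌(T) < ∞`.

* `Measure.ext_of_isOpen_subset` — measures over `Ω`, finite on compact subsets of `Ω`, are
  determined by their values on the open subsets of `Ω`; hence
  `variation_vectorCurrent_eq : ‖μ ∧ F‖ = (‖F‖ μ) ⌞ Ω` and
  `IsRectifiableData.variation_eq : ‖[W, θ, ξ]‖ = |θ| 𝓗ᵐ ⌞ W` (Federer 4.1.28 (5)).

No named facts; the measure is a definition with its characterising theorems.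

## References

* H. Federer, *Geometric Measure Theory*, Springer 1969, 2.2.5 (Radon measures from their values
  on open sets), 4.1.5, 4.1.7 [Federer1969].
-/

noncomputable section

open scoped Distributions ENNReal NNReal Topology ContDiff
open MeasureTheory TopologicalSpace Set Filter Metric

namespace Literature.Geometry.GeometricMeasureTheory

set_option maxSynthPendingDepth 3

/-! ### Additivity properties of `‖T‖(U)` -/

section Additivity

variable {E : Type*} [NormedAddCommGroup E] [NormedSpace ℝ E] {Ω : Opens E} {m : ℕ}

/-- Test forms supported in `U` are supported in `U ∩ Ω`: `‖T‖(U) = ‖T‖(U ∩ Ω)`.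
[cite: Federer1969, 4.1.5] -/
theorem Current.variationOn_inter_eq (T : Current Ω m) (U : Set E) :
    T.variationOn (U ∩ (Ω : Set E)) = T.variationOn U := by
  refine le_antisymm (T.variationOn_mono inter_subset_left) ?_
  exact iSup_le fun φ => iSup_le fun hφ => iSup_le fun hU =>
    T.ofReal_apply_le_variationOn hφ (subset_inter hU φ.tsupport_subset)

/-- Two test forms of comass `≤ 1` with disjoint supports add up to a test form of comass `≤ 1`.
[folklore] -/
theorem TestForm.norm_add_le_one_of_disjoint {φ₁ φ₂ : TestForm Ω m} (h₁ : ∀ x, ‖φ₁ x‖ ≤ 1)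
    (h₂ : ∀ x, ‖φ₂ x‖ ≤ 1) (hd : Disjoint (tsupport ⇑φ₁) (tsupport ⇑φ₂)) (x : E) :
    ‖(φ₁ + φ₂) x‖ ≤ 1 := by
  show ‖φ₁ x + φ₂ x‖ ≤ 1
  by_cases hx : x ∈ tsupport ⇑φ₁
  · rw [image_eq_zero_of_notMem_tsupport (hd.notMem_of_mem_left hx), add_zero]; exact h₁ x
  · rw [image_eq_zero_of_notMem_tsupport hx, zero_add]; exact h₂ x

/-- The zero form is admissible for every set. [folklore] -/
theorem TestForm.tsupport_zero_subset (U : Set E) : tsupport ⇑(0 : TestForm Ω m) ⊆ U := by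
  have h : tsupport ⇑(0 : TestForm Ω m) = ∅ := tsupport_eq_empty_iff.2 rfl
  rw [h]
  exact empty_subset U

/-- `‖T‖(U)` as a supremum over the subtype of admissible forms. [folklore] -/
theorem Current.variationOn_eq_iSup_subtype (T : Current Ω m) (U : Set E) :
    T.variationOn U = ⨆ p : {φ : TestForm Ω m // (∀ x, ‖φ x‖ ≤ 1) ∧ tsupport ⇑φ ⊆ U},
      ENNReal.ofReal (T p.1) := by
  apply le_antisymm
  · exact iSup_le fun φ => iSup_le fun h1 => iSup_le fun h2 =>
      le_iSup (fun p : {φ : TestForm Ω m // (∀ x, ‖φ x‖ ≤ 1) ∧ tsupport ⇑φ ⊆ U} =>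
        ENNReal.ofReal (T p.1)) ⟨φ, h1, h2⟩
  · exact iSup_le fun p => T.ofReal_apply_le_variationOn p.2.1 p.2.2

/-- An admissible form may be replaced by one on which `T` is nonnegative without changing
`ofReal (T φ)`. [folklore] -/
theorem Current.exists_nonneg_replacement (T : Current Ω m) {U : Set E} (φ : TestForm Ω m)
    (h : ∀ x, ‖φ x‖ ≤ 1) (hU : tsupport ⇑φ ⊆ U) :
    ∃ ψ : TestForm Ω m, (∀ x, ‖ψ x‖ ≤ 1) ∧ tsupport ⇑ψ ⊆ U ∧ 0 ≤ T ψ ∧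
      ENNReal.ofReal (T φ) = ENNReal.ofReal (T ψ) := by
  rcases le_or_gt 0 (T φ) with hp | hn
  · exact ⟨φ, h, hU, hp, rfl⟩
  · refine ⟨0, fun x => by simp, TestForm.tsupport_zero_subset U, by simp, ?_⟩
    rw [map_zero, ENNReal.ofReal_zero, ENNReal.ofReal_of_nonpos hn.le]

/-- **Superadditivity on disjoint sets**: `‖T‖(U₁) + ‖T‖(U₂) ≤ ‖T‖(U₁ ∪ U₂)` when
`U₁ ∩ U₂ = ∅` (add up nearly optimal test forms; their supports are disjoint).
[cite: Federer1969, 4.1.5] -/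
theorem Current.add_le_variationOn_union (T : Current Ω m) {U₁ U₂ : Set E}
    (hd : Disjoint U₁ U₂) : T.variationOn U₁ + T.variationOn U₂ ≤ T.variationOn (U₁ ∪ U₂) := by
  -- every pair of admissible forms is dominated
  have key : ∀ φ₁ φ₂ : TestForm Ω m, (∀ x, ‖φ₁ x‖ ≤ 1) → tsupport ⇑φ₁ ⊆ U₁ →
      (∀ x, ‖φ₂ x‖ ≤ 1) → tsupport ⇑φ₂ ⊆ U₂ →
      ENNReal.ofReal (T φ₁) + ENNReal.ofReal (T φ₂) ≤ T.variationOn (U₁ ∪ U₂) := by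
    intro φ₁ φ₂ h₁ hU₁ h₂ hU₂
    obtain ⟨ψ₁, hψ₁, hψU₁, hp₁, he₁⟩ := T.exists_nonneg_replacement φ₁ h₁ hU₁
    obtain ⟨ψ₂, hψ₂, hψU₂, hp₂, he₂⟩ := T.exists_nonneg_replacement φ₂ h₂ hU₂
    rw [he₁, he₂, ← ENNReal.ofReal_add hp₁ hp₂, ← map_add]
    have hdis : Disjoint (tsupport ⇑ψ₁) (tsupport ⇑ψ₂) := hd.mono hψU₁ hψU₂
    refine T.ofReal_apply_le_variationOn (TestForm.norm_add_le_one_of_disjoint hψ₁ hψ₂ hdis) ?_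
    rw [FunLike.coe_add]
    exact (tsupport_add (⇑ψ₁) (⇑ψ₂)).trans (union_subset_union hψU₁ hψU₂)
  -- pass to the suprema
  rw [T.variationOn_eq_iSup_subtype U₁, T.variationOn_eq_iSup_subtype U₂]
  haveI : Nonempty {φ : TestForm Ω m // (∀ x, ‖φ x‖ ≤ 1) ∧ tsupport ⇑φ ⊆ U₁} :=
    ⟨⟨0, fun x => by simp, TestForm.tsupport_zero_subset U₁⟩⟩
  haveI : Nonempty {φ : TestForm Ω m // (∀ x, ‖φ x‖ ≤ 1) ∧ tsupport ⇑φ ⊆ U₂} :=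
    ⟨⟨0, fun x => by simp, TestForm.tsupport_zero_subset U₂⟩⟩
  rw [ENNReal.iSup_add]
  refine iSup_le fun p => ?_
  rw [ENNReal.add_iSup]
  exact iSup_le fun q => key p.1 q.1 p.2.1 p.2.2 q.2.1 q.2.2

end Additivity

section Subadditivity

variable {E : Type*} [NormedAddCommGroup E] [NormedSpace ℝ E] [FiniteDimensional ℝ E]
  {Ω : Opens E} {m : ℕ}

open scoped Manifold in
/-- **Countable subadditivity on open sets**: `‖T‖(⋃ Uᵢ) ≤ Σᵢ ‖T‖(Uᵢ)` — split an admissible form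
`φ` supported in `⋃ Uᵢ` as `Σ ρᵢ φ` with a smooth partition of unity subordinate to a finite
subcover of `spt φ`. [cite: Federer1969, 4.1.5] -/
theorem Current.variationOn_iUnion_le (T : Current Ω m) {U : ℕ → Set E} (hU : ∀ i, IsOpen (U i)) :
    T.variationOn (⋃ i, U i) ≤ ∑' i, T.variationOn (U i) := by
  refine iSup_le fun φ => iSup_le fun hφ => iSup_le fun hφU => ?_
  obtain ⟨t, ht⟩ := φ.hasCompactSupport.isCompact.elim_finite_subcover U hU hφU
  have hcov : tsupport ⇑φ ⊆ ⋃ i : (↑t : Set ℕ), U (i : ℕ) := by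
    intro x hx
    obtain ⟨i, hi, hx'⟩ := mem_iUnion₂.1 (ht hx)
    exact mem_iUnion.2 ⟨⟨i, hi⟩, hx'⟩
  obtain ⟨ρ, hρ⟩ := SmoothPartitionOfUnity.exists_isSubordinate 𝓘(ℝ, E) (isClosed_tsupport ⇑φ)
    (fun i : (↑t : Set ℕ) => U (i : ℕ)) (fun i => hU i) hcov
  have hsm : ∀ i : (↑t : Set ℕ), ContDiff ℝ ∞ (fun x => ρ i x • φ x) := fun i =>
    (contMDiff_iff_contDiff.1 (ρ i).contMDiff).smul φ.contDiff
  let ψ : (↑t : Set ℕ) → TestForm Ω m := fun i =>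
    ⟨fun x => ρ i x • φ x, hsm i, φ.hasCompactSupport.smul_left (f := ⇑(ρ i)),
      (tsupport_smul_subset_right (fun x => ρ i x) ⇑φ).trans φ.tsupport_subset⟩
  have hψ1 : ∀ i x, ‖ψ i x‖ ≤ 1 := fun i x => by
    change ‖ρ i x • φ x‖ ≤ 1
    rw [norm_smul, Real.norm_of_nonneg (ρ.nonneg i x)]
    exact mul_le_one₀ (ρ.le_one i x) (norm_nonneg _) (hφ x)
  have hψU : ∀ i, tsupport ⇑(ψ i) ⊆ U (i : ℕ) := fun i =>
    (tsupport_smul_subset_left (fun x => ρ i x) ⇑φ).trans (hρ i)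
  have hsum : φ = ∑ i, ψ i := by
    apply TestFunction.ext
    intro x
    rw [sum_apply]
    change φ x = ∑ i, ρ i x • φ x
    rw [← Finset.sum_smul]
    by_cases hx : x ∈ tsupport ⇑φ
    · rw [← finsum_eq_sum_of_fintype, ρ.sum_eq_one hx, one_smul]
    · rw [image_eq_zero_of_notMem_tsupport hx, smul_zero]
  calc ENNReal.ofReal (T φ) = ENNReal.ofReal (∑ i, T (ψ i)) := by rw [hsum, map_sum]
    _ ≤ ∑ i, ENNReal.ofReal (T (ψ i)) :=
        Finset.le_sum_of_subadditive _ ENNReal.ofReal_zero.le (fun a b => ENNReal.ofReal_add_le)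
          _ _
    _ ≤ ∑ i : (↑t : Set ℕ), T.variationOn (U (i : ℕ)) :=
        Finset.sum_le_sum fun i _ => T.ofReal_apply_le_variationOn (hψ1 i) (hψU i)
    _ = ∑ i ∈ t, T.variationOn (U i) := Finset.sum_coe_sort t fun i => T.variationOn (U i)
    _ ≤ ∑' i, T.variationOn (U i) := ENNReal.sum_le_tsum t

end Subadditivity

/-! ### The outer measure induced by `‖T‖` on open sets -/

section Outer

variable {E : Type*} [NormedAddCommGroup E] [NormedSpace ℝ E] [FiniteDimensional ℝ E]
  {Ω : Opens E} {m : ℕ}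

/-- The outer measure `A ↦ inf {‖T‖(U) : U ⊇ A open}` induced by the variation on open sets.
[cite: Federer1969, 2.2.5 and 4.1.5] -/
def Current.variationOuter (T : Current Ω m) : OuterMeasure E :=
  inducedOuterMeasure (fun U (_ : IsOpen U) => T.variationOn U) isOpen_empty T.variationOn_empty

/-- Countable unions of open sets are open (in the shape `inducedOuterMeasure` wants). [folklore] -/
theorem isOpen_iUnion' {X : Type*} [TopologicalSpace X] ⦃f : ℕ → Set X⦄
    (hf : ∀ i, IsOpen (f i)) : IsOpen (⋃ i, f i) :=
  isOpen_iUnion hf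

/-- `variationOuter` agrees with `‖T‖(U)` on open sets. [cite: Federer1969, 2.2.5] -/
theorem Current.variationOuter_apply_of_isOpen (T : Current Ω m) {U : Set E} (hU : IsOpen U) :
    T.variationOuter U = T.variationOn U :=
  inducedOuterMeasure_eq' isOpen_iUnion' (fun _ hf => T.variationOn_iUnion_le hf)
    (fun _ _ _ _ h => T.variationOn_mono h) hU

/-- `variationOuter A = inf {‖T‖(U) : U ⊇ A open}`. [cite: Federer1969, 2.2.5] -/
theorem Current.variationOuter_eq_iInf (T : Current Ω m) (A : Set E) :
    T.variationOuter A = ⨅ (U : Set E) (_ : IsOpen U) (_ : A ⊆ U), T.variationOn U :=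
  inducedOuterMeasure_eq_iInf isOpen_iUnion' (fun _ hf => T.variationOn_iUnion_le hf)
    (fun _ _ _ _ h => T.variationOn_mono h) A

/-- **Open sets are Carathéodory measurable for `variationOuter`**: for open `s, t`,
`‖T‖(t ∩ s) + μ(t ∖ s) ≤ ‖T‖(t)` — take `φ₁` admissible for `t ∩ s`; then `t ∖ spt φ₁` is an open
set containing `t ∖ s`, and forms supported there add to `φ₁` without overlap.
[cite: Federer1969, 2.2.5] -/
theorem Current.isCaratheodory_of_isOpen (T : Current Ω m) {s : Set E} (hs : IsOpen s) :
    MeasurableSet[T.variationOuter.caratheodory] s := by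
  rw [Current.variationOuter, inducedOuterMeasure_caratheodory]
  · intro t ht
    change T.variationOuter (t ∩ s) + T.variationOuter (t \ s) ≤ T.variationOuter t
    rw [T.variationOuter_apply_of_isOpen (ht.inter hs), T.variationOuter_apply_of_isOpen ht,
      T.variationOn_eq_iSup_subtype (t ∩ s)]
    haveI : Nonempty {φ : TestForm Ω m // (∀ x, ‖φ x‖ ≤ 1) ∧ tsupport ⇑φ ⊆ t ∩ s} :=
      ⟨⟨0, fun x => by simp, TestForm.tsupport_zero_subset (t ∩ s)⟩⟩
    rw [ENNReal.iSup_add]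
    refine iSup_le fun p => ?_
    -- `t \ spt φ₁` is open and contains `t \ s`
    have hC : IsClosed (tsupport ⇑p.1) := isClosed_tsupport _
    have hsub : t \ s ⊆ t \ tsupport ⇑p.1 := Set.sdiff_subset_sdiff_right (p.2.2.trans inter_subset_right)
    calc ENNReal.ofReal (T p.1) + T.variationOuter (t \ s)
        ≤ ENNReal.ofReal (T p.1) + T.variationOuter (t \ tsupport ⇑p.1) :=
          add_le_add le_rfl (T.variationOuter.mono hsub)
      _ = ENNReal.ofReal (T p.1) + T.variationOn (t \ tsupport ⇑p.1) := by
          rw [T.variationOuter_apply_of_isOpen (ht.sdiff hC)]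
      _ ≤ T.variationOn (tsupport ⇑p.1) + T.variationOn (t \ tsupport ⇑p.1) :=
          add_le_add (T.ofReal_apply_le_variationOn p.2.1 Subset.rfl) le_rfl
      _ ≤ T.variationOn (tsupport ⇑p.1 ∪ (t \ tsupport ⇑p.1)) :=
          T.add_le_variationOn_union disjoint_sdiff_right
      _ ≤ T.variationOn t := T.variationOn_mono
          (union_subset (p.2.2.trans inter_subset_left) Set.sdiff_subset)
  · exact isOpen_iUnion'
  · exact fun _ hf => T.variationOn_iUnion_le hf
  · exact fun _ _ _ _ h => T.variationOn_mono h

end Outer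

/-! ### The variation measure -/

section Measure

variable {E : Type*} [NormedAddCommGroup E] [NormedSpace ℝ E] [FiniteDimensional ℝ E]
  [MeasurableSpace E] [BorelSpace E] {Ω : Opens E} {m : ℕ}

/-- The Borel σ-algebra is Carathéodory measurable for `variationOuter`. [cite: Federer1969, 2.2.5] -/
theorem Current.borel_le_caratheodory (T : Current Ω m) :
    ‹MeasurableSpace E› ≤ T.variationOuter.caratheodory := by
  rw [‹BorelSpace E›.measurable_eq]
  exact MeasurableSpace.generateFrom_le fun s hs => T.isCaratheodory_of_isOpen hs

/-- **The variation measure `‖T‖` of a current** `T ∈ 𝒟_m(Ω)` [Federer1969, 4.1.5, 4.1.7]: the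
Borel measure with `‖T‖(U) = sup {T(φ) : spt φ ⊆ U, ‖φ‖ ≤ 1}` for open `U`, constructed as the
measure induced by these values (2.2.5) and restricted to `Ω` (it is a measure "over `Ω`":
`‖T‖(E ∖ Ω) = 0`). For `T = μ ∧ F` it is `‖F‖ μ`, for `T = [W, θ, ξ]` it is `|θ| 𝓗ᵐ ⌞ W` (see
`CurrentsVariation.lean` for the values on open sets). [cite: Federer1969, 4.1.5] -/
def Current.variation (T : Current Ω m) : Measure E :=
  (T.variationOuter.toMeasure T.borel_le_caratheodory).restrict (Ω : Set E)

/-- `‖T‖(A) = variationOuter (A ∩ Ω)` for Borel `A`. [cite: Federer1969, 4.1.5] -/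
theorem Current.variation_apply (T : Current Ω m) {A : Set E} (hA : MeasurableSet A) :
    T.variation A = T.variationOuter (A ∩ (Ω : Set E)) := by
  rw [Current.variation, Measure.restrict_apply hA,
    toMeasure_apply _ _ (hA.inter Ω.isOpen.measurableSet)]

/-- **`‖T‖(U) = sup {T(φ) : spt φ ⊆ U, ‖φ‖ ≤ 1}` for open `U`.** [cite: Federer1969, 4.1.5] -/
theorem Current.variation_apply_of_isOpen (T : Current Ω m) {U : Set E} (hU : IsOpen U) :
    T.variation U = T.variationOn U := by
  rw [T.variation_apply hU.measurableSet, T.variationOuter_apply_of_isOpen (hU.inter Ω.isOpen),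
    T.variationOn_inter_eq]

/-- **`‖T‖(E) = 𝐌(T)`.** [cite: Federer1969, 4.1.7] -/
theorem Current.variation_univ (T : Current Ω m) : T.variation univ = T.mass := by
  rw [T.variation_apply_of_isOpen isOpen_univ, T.variationOn_univ]

/-- `‖T‖(A) ≤ 𝐌(T)`. [cite: Federer1969, 4.1.7] -/
theorem Current.variation_le_mass (T : Current Ω m) (A : Set E) : T.variation A ≤ T.mass := by
  rw [← T.variation_univ]
  exact measure_mono (subset_univ A)

/-- `‖T‖` lives on `Ω`: `‖T‖(E ∖ Ω) = 0`. [cite: Federer1969, 4.1.5] -/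
@[simp] theorem Current.variation_compl (T : Current Ω m) : T.variation (Ω : Set E)ᶜ = 0 := by
  rw [Current.variation, Measure.restrict_apply Ω.isOpen.measurableSet.compl, compl_inter_self,
    measure_empty]

/-- **Outer regularity inside `Ω`**: `‖T‖(A) = inf {‖T‖(U) : U open, A ∩ Ω ⊆ U}` for Borel `A`.
[cite: Federer1969, 2.2.5] -/
theorem Current.variation_eq_iInf_isOpen (T : Current Ω m) {A : Set E} (hA : MeasurableSet A) :
    T.variation A = ⨅ (U : Set E) (_ : IsOpen U) (_ : A ∩ (Ω : Set E) ⊆ U), T.variationOn U := by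
  rw [T.variation_apply hA, T.variationOuter_eq_iInf]

/-- **`T(φ) ≤ ‖T‖(spt φ)` for `‖φ‖ ≤ 1`** (and hence `T(φ) ≤ ‖T‖(K)` for every Borel
`K ⊇ spt φ`). [cite: Federer1969, 4.1.5] -/
theorem Current.ofReal_apply_le_variation (T : Current Ω m) {φ : TestForm Ω m}
    (hφ : ∀ x, ‖φ x‖ ≤ 1) : ENNReal.ofReal (T φ) ≤ T.variation (tsupport ⇑φ) := by
  rw [T.variation_eq_iInf_isOpen (isClosed_tsupport _).measurableSet,
    inter_eq_self_of_subset_left φ.tsupport_subset]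
  exact le_iInf fun U => le_iInf fun _ => le_iInf fun hU => T.ofReal_apply_le_variationOn hφ hU

/-- `‖T‖` is a finite measure when `𝐌(T) < ∞`. [cite: Federer1969, 4.1.7] -/
theorem Current.isFiniteMeasure_variation (T : Current Ω m) (h : T.mass ≠ ⊤) :
    IsFiniteMeasure T.variation :=
  ⟨by rw [T.variation_univ]; exact h.lt_top⟩

/-- `‖0‖ = 0`. [folklore] -/
@[simp] theorem Current.variation_zero : (0 : Current Ω m).variation = 0 := by
  refine Measure.ext fun A hA => ?_
  rw [Current.variation_eq_iInf_isOpen _ hA, Measure.coe_zero, Pi.zero_apply]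
  refine le_antisymm ?_ bot_le
  exact iInf_le_of_le univ (iInf_le_of_le isOpen_univ (iInf_le_of_le (subset_univ _) (by simp)))

/-- `‖-T‖ = ‖T‖`. [folklore] -/
@[simp] theorem Current.variation_neg (T : Current Ω m) : (-T).variation = T.variation := by
  refine Measure.ext fun A hA => ?_
  simp only [Current.variation_eq_iInf_isOpen _ hA, Current.variationOn_neg]

end Measure

/-! ### Uniqueness of measures over `Ω` from their values on open subsets of `Ω` -/

section Ext

variable {E : Type*} [NormedAddCommGroup E] [NormedSpace ℝ E] [FiniteDimensional ℝ E]
  [MeasurableSpace E] [BorelSpace E]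

omit [MeasurableSpace E] [BorelSpace E] in
/-- An increasing sequence of open sets with compact closures in `Ω` exhausting `Ω`. [folklore] -/
theorem exists_isOpen_exhaustion (Ω : Opens E) :
    ∃ O : ℕ → Set E, (∀ n, IsOpen (O n)) ∧ Monotone O ∧ (∀ n, IsCompact (closure (O n))) ∧
      (∀ n, closure (O n) ⊆ (Ω : Set E)) ∧ (⋃ n, O n) = (Ω : Set E) := by
  obtain ⟨K, hKc, hKΩ, hKabs⟩ := exists_compact_exhaustion Ω
  refine ⟨fun n => interior (Set.accumulate K n), fun n => isOpen_interior,
    fun i j hij => interior_mono (Set.monotone_accumulate hij), fun n => ?_, fun n => ?_, ?_⟩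
  · exact (isCompact_accumulate hKc n).of_isClosed_subset isClosed_closure
      (closure_minimal interior_subset (isCompact_accumulate hKc n).isClosed)
  · exact (closure_minimal interior_subset (isCompact_accumulate hKc n).isClosed).trans
      (iUnion₂_subset fun i _ => hKΩ i)
  · refine Subset.antisymm (iUnion_subset fun n => interior_subset.trans
      (iUnion₂_subset fun i _ => hKΩ i)) fun x hx => ?_
    obtain ⟨r, hr, hrΩ⟩ := Metric.nhds_basis_closedBall.mem_iff.1 (Ω.isOpen.mem_nhds hx)
    obtain ⟨n, hn⟩ := hKabs _ (isCompact_closedBall x r) hrΩ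
    exact mem_iUnion.2 ⟨n, interior_mono (hn.trans Set.subset_accumulate)
      (mem_interior_iff_mem_nhds.2 (Metric.closedBall_mem_nhds x hr))⟩

/-- **Two measures over `Ω` agreeing on the open subsets of `Ω` coincide**, provided one of them is
finite on the compact subsets of `Ω` and both vanish off `Ω` (Radon measures on `Ω` are determined
by their values on open sets). [cite: Federer1969, 2.2.5] -/
theorem Measure.ext_of_isOpen_subset (Ω : Opens E) {μ ν : Measure E} (hμ : μ (Ω : Set E)ᶜ = 0)
    (hν : ν (Ω : Set E)ᶜ = 0) (hfin : ∀ K : Set E, IsCompact K → K ⊆ (Ω : Set E) → ν K ≠ ⊤)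
    (h : ∀ U : Set E, IsOpen U → U ⊆ (Ω : Set E) → μ U = ν U) : μ = ν := by
  obtain ⟨O, hO, hmono, hcl, hclΩ, hUnion⟩ := exists_isOpen_exhaustion Ω
  -- the restrictions to `O n` are finite and agree on open sets, hence agree
  have hres : ∀ n, μ.restrict (O n) = ν.restrict (O n) := by
    intro n
    have hOΩ : O n ⊆ (Ω : Set E) := subset_closure.trans (hclΩ n)
    have hfinν : ν (O n) ≠ ⊤ :=
      ne_top_of_le_ne_top (hfin _ (hcl n) (hclΩ n)) (measure_mono subset_closure)
    haveI : IsFiniteMeasure (ν.restrict (O n)) := ⟨by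
      rw [Measure.restrict_apply_univ]; exact hfinν.lt_top⟩
    haveI : IsFiniteMeasure (μ.restrict (O n)) := ⟨by
      rw [Measure.restrict_apply_univ, h _ (hO n) hOΩ]; exact hfinν.lt_top⟩
    refine ext_of_generate_finite _ (‹BorelSpace E›.measurable_eq.trans rfl) isPiSystem_isOpen
      (fun U hU => ?_) ?_
    · rw [Measure.restrict_apply' (hO n).measurableSet, Measure.restrict_apply' (hO n).measurableSet]
      exact h _ ((show IsOpen U from hU).inter (hO n)) (inter_subset_right.trans hOΩ)
    · rw [Measure.restrict_apply_univ, Measure.restrict_apply_univ]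
      exact h _ (hO n) hOΩ
  refine Measure.ext fun A hA => ?_
  -- `μ A = μ (A ∩ Ω) = sup μ (A ∩ O n)`
  have key : ∀ ρ : Measure E, ρ (Ω : Set E)ᶜ = 0 → ρ A = ⨆ n, ρ.restrict (O n) A := by
    intro ρ hρ
    have h1 : ρ A = ρ (A ∩ (Ω : Set E)) := by
      refine le_antisymm ?_ (measure_mono inter_subset_left)
      calc ρ A ≤ ρ (A ∩ (Ω : Set E)) + ρ (A \ (Ω : Set E)) := measure_le_inter_add_sdiff ρ A _
        _ ≤ ρ (A ∩ (Ω : Set E)) + ρ (Ω : Set E)ᶜ :=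
            add_le_add le_rfl (measure_mono fun x hx => hx.2)
        _ = ρ (A ∩ (Ω : Set E)) := by rw [hρ, add_zero]
    rw [h1, ← hUnion, inter_iUnion]
    rw [(monotone_const.inter hmono).measure_iUnion]
    exact iSup_congr fun n => (Measure.restrict_apply hA).symm
  rw [key μ hμ, key ν hν]
  exact iSup_congr fun n => by rw [hres n]

end Ext

/-! ### Identification for currents representable by integration -/

section Identification

variable {V : Type*} [NormedAddCommGroup V] [InnerProductSpace ℝ V] [FiniteDimensional ℝ V]
  [MeasurableSpace V] [BorelSpace V] {Ω : Opens V} {m : ℕ}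

/-- **`‖μ ∧ F‖ = (‖F‖ μ) ⌞ Ω`** for `F` locally `μ`-integrable on `Ω` ("‖μ ∧ η‖ = μ ⌞ ‖η‖").
[cite: Federer1969, 4.1.5] -/
theorem variation_vectorCurrent_eq {μ : Measure V} {F : V → Multivector V m}
    (hF : LocallyIntegrableOn F (Ω : Set V) μ) :
    (vectorCurrent μ F : Current Ω m).variation =
      (μ.withDensity fun x => ‖F x‖ₑ).restrict (Ω : Set V) := by
  refine Measure.ext_of_isOpen_subset Ω (Current.variation_compl _)
    (by rw [Measure.restrict_apply Ω.isOpen.measurableSet.compl, compl_inter_self, measure_empty])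
    (fun K hK hKΩ => ?_) (fun U hU hUΩ => ?_)
  · rw [Measure.restrict_apply hK.isClosed.measurableSet, inter_eq_self_of_subset_left hKΩ,
      withDensity_apply _ hK.isClosed.measurableSet]
    exact ((hF.integrableOn_compact_subset hKΩ hK).2).ne
  · rw [Current.variation_apply_of_isOpen _ hU, variationOn_vectorCurrent_eq hF hU hUΩ,
      Measure.restrict_apply hU.measurableSet, inter_eq_self_of_subset_left hUΩ,
      withDensity_apply _ hU.measurableSet]

/-- **`‖[W, θ, ξ]‖ = |θ| 𝓗ᵐ ⌞ W`** for admissible data: the variation measure of a current of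
integration [Federer1969, 4.1.28 (5): "‖T‖ = 𝓗^m ⌞ Θ^m(‖T‖, ·)" with density `|θ|` on `W`].
[cite: Federer1969, 4.1.28 (5)] -/
theorem IsRectifiableData.variation_eq {W : Set V} {θ : V → ℤ} {ξ : V → Fin m → V}
    (h : IsRectifiableData Ω m W θ ξ) :
    (currentOfIntegration W θ ξ : Current Ω m).variation =
      ((μHE[m] : Measure V).restrict W).withDensity fun x => ‖(θ x : ℝ)‖ₑ := by
  have hW : W ⊆ (Ω : Set V) := h.2.1
  rw [currentOfIntegration, variation_vectorCurrent_eq h.2.2.2.1]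
  have hae : (fun x => ‖(θ x : ℝ) • frameVector (ξ x)‖ₑ) =ᵐ[(μHE[m] : Measure V).restrict W]
      fun x => ‖(θ x : ℝ)‖ₑ := by
    filter_upwards [h.2.2.2.2] with x hx
    rw [enorm_smul, ← ofReal_norm (frameVector (ξ x)), norm_frameVector_eq_one hx.1,
      ENNReal.ofReal_one, mul_one]
  rw [withDensity_congr_ae hae]
  refine Measure.restrict_eq_self_of_ae_mem ?_
  have h1 : ∀ᵐ x ∂((μHE[m] : Measure V).restrict W), x ∈ (Ω : Set V) :=
    (ae_restrict_mem h.1).mono fun x hx => hW hx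
  exact (withDensity_absolutelyContinuous _ _).ae_le h1

/-- Hence `‖[W, θ, ξ]‖(A) = ∫_{W ∩ A} |θ| d𝓗ᵐ` for every Borel `A`. [cite: Federer1969, 4.1.28 (5)] -/
theorem IsRectifiableData.variation_apply {W : Set V} {θ : V → ℤ} {ξ : V → Fin m → V}
    (h : IsRectifiableData Ω m W θ ξ) {A : Set V} (hA : MeasurableSet A) :
    (currentOfIntegration W θ ξ : Current Ω m).variation A =
      ∫⁻ x in W ∩ A, ‖(θ x : ℝ)‖ₑ ∂(μHE[m] : Measure V) := by
  rw [h.variation_eq, withDensity_apply _ hA, Measure.restrict_restrict hA, inter_comm]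

end Identification

end Literature.Geometry.GeometricMeasureTheory
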